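import Summits.ABC.ABC.Theses.IsogenyGlueCongruence
import Literature.NumberTheory.EllipticCurves.PastenSpectralDegree
import Literature.NumberTheory.EllipticCurves.PastenSpectralDegreeProductFormProofs
import Literature.NumberTheory.EllipticCurves.PastenCongruenceModulusProofs
import Literature.NumberTheory.EllipticCurves.NewformsLevelRaising
import Literature.NumberTheory.EllipticCurves.LFunctionCoefficientBound
import HarnessLib

/-!
# Crux A `DegreePrimesPolyBounded` (stmt-ABC-2045), line `Sketch` — the glue stub `stub_glue`

The kernel-checked REDUCTION of crux A (every prime factor of the modular degree of a semistable
`E/ℚ` is `≤ C N^κ`) to five named statements, four of them known mathematics and one the line's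
E-free bet:

1. (fact, BCDT + Edixhoven + Mazur–Kenku) a semistable globally minimal `W` of conductor `N` carries
   a datum of degree `k · δ`, `1 ≤ k ≤ 163`, `δ` the class-minimal (optimal) degree;
2. (Pasten 2024 Thm 5.5, PROVED in the tree: `stub_spectral`) `δ ∣ ∏_{P ≠ 𝕀_f} η_f(P)`;
3. (Atkin–Lehner–Li, PROVED in the tree: `stub_minimalPrimes`) minimal primes of `𝕋_N` are
   eigen-ideals of newforms of level `N` or of lifts of newforms of proper divisor levels;
4. (Carayol + Mazur + Tate curve) an old congruence prime `ℓ ≥ 11`, `ℓ ∤ N`, divides some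
   `v_p(Δ_min) > 0`;
5. (Pasten Thm 1.9 + Silverman) `v_p(Δ_min) ≤ C N^κ`;
6. THE BET `SmallHeckeSeparators` (E-free): two newforms `f ≠ g` of level `N`, `f` rational, are
   separated by `t = Σ_{p ≤ CN^A, p ∤ N} u_p T_p ∈ 𝕀_g ∖ 𝕀_f` with `|u_p| ≤ C N^A`.

`stub_glue : (1) → (2) → (3) → (4) → (5) → (6) → DegreePrimesPolyBounded`.  The E-free transfer
(6) ⟹ "same-level congruence primes of `f_W` are `≤ 4 (max C 1)³ N^{3A}`" is Pasten's Prop 5.4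
(`η ∣ χ₀(t)`, tree) with Hasse's bound `|a_p(W)| ≤ 2√p` (tree, `abs_LFunction_prime_pow_le`):
`ℓ ≤ η ≤ |χ₀(t)| = |Σ u_p a_p(W)| ≤ (CN^A + 1) · CN^A · 2CN^A ≤ 3 (CN^A)³`.
-/

set_option linter.dupNamespace false

noncomputable section

open scoped MatrixGroups ModularForm
open CongruenceSubgroup UpperHalfPlane
open Literature.NumberTheory.EllipticCurves.ModularForms
open Summit.ABC.ABC.Theses.IsogenyGlueCongruence

namespace Summit.ABC.ABC.Theorems.DegreePrimesPolyBounded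

/-! ## Real-analysis bookkeeping -/

/-- Bookkeeping: enlarge constant and exponent (`N ≥ 1`, `0 ≤ C`). -/
theorem le_of_le_mul_rpow {x C' κ' C κ N : ℝ} (h : x ≤ C' * N ^ κ') (hC : C' ≤ C) (hκ : κ' ≤ κ)
    (hC0 : 0 ≤ C) (hN : 1 ≤ N) : x ≤ C * N ^ κ := by
  have hN0 : 0 ≤ N := zero_le_one.trans hN
  calc x ≤ C' * N ^ κ' := h
    _ ≤ C * N ^ κ' := mul_le_mul_of_nonneg_right hC (Real.rpow_nonneg hN0 _)
    _ ≤ C * N ^ κ := mul_le_mul_of_nonneg_left (Real.rpow_le_rpow_of_exponent_le hN hκ) hC0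

/-- Bookkeeping: a constant is below `C N^κ` (`N ≥ 1`, `0 ≤ κ`, `x ≤ C`, `0 ≤ C`). -/
theorem le_mul_rpow_of_le {x C κ N : ℝ} (h : x ≤ C) (hC0 : 0 ≤ C) (hκ : 0 ≤ κ) (hN : 1 ≤ N) :
    x ≤ C * N ^ κ := by
  calc x ≤ C * 1 := by rw [mul_one]; exact h
    _ ≤ C * N ^ κ := mul_le_mul_of_nonneg_left (Real.one_le_rpow hN hκ) hC0

/-- Bookkeeping: `N ≤ C N^κ` for `1 ≤ C`, `1 ≤ κ`, `1 ≤ N`. -/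
theorem self_le_mul_rpow {C κ N : ℝ} (hC : 1 ≤ C) (hκ : 1 ≤ κ) (hN : 1 ≤ N) : N ≤ C * N ^ κ := by
  have hN0 : 0 ≤ N := zero_le_one.trans hN
  calc N = 1 * N ^ (1 : ℝ) := by rw [one_mul, Real.rpow_one]
    _ ≤ C * N ^ (1 : ℝ) := mul_le_mul_of_nonneg_right hC (Real.rpow_nonneg hN0 _)
    _ ≤ C * N ^ κ :=
        mul_le_mul_of_nonneg_left (Real.rpow_le_rpow_of_exponent_le hN hκ) (zero_le_one.trans hC)

/-- Counting: a finite set of naturals all `≤ M` has at most `M + 1` elements. -/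
theorem card_le_of_forall_le {S : Finset ℕ} {M : ℝ} (hM : 0 ≤ M) (h : ∀ p ∈ S, (p : ℝ) ≤ M) :
    (S.card : ℝ) ≤ M + 1 := by
  have hsub : S ⊆ Finset.range (⌊M⌋₊ + 1) := by
    intro p hp
    rw [Finset.mem_range]
    have := Nat.le_floor (h p hp)
    omega
  calc (S.card : ℝ) ≤ ((Finset.range (⌊M⌋₊ + 1)).card : ℝ) := by
        exact_mod_cast Finset.card_le_card hsub
    _ = ⌊M⌋₊ + 1 := by rw [Finset.card_range]; push_cast; ring
    _ ≤ M + 1 := by linarith [Nat.floor_le hM]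

/-! ## Hecke-side lemmas on the newform of an elliptic curve -/

section Hecke

variable {W : WeierstrassCurve ℚ} {N : ℕ} [NeZero N]

/-- A newform is nonzero (`a₁ = 1`). -/
theorem newform_ne_zero {g : CuspForm (Gamma0 N) 2} (hg : IsNewform0 g) : g ≠ 0 := by
  intro h
  have h1 : (qExpansion 1 ⇑g).coeff 1 = 1 := hg.2.2
  rw [h, CuspForm.coe_zero, UpperHalfPlane.qExpansion_zero, map_zero] at h1
  exact zero_ne_one h1

/-- The eigen-ideal of a newform is a minimal prime of `𝕋`. -/
theorem newform_eigenIdeal_mem_minimalPrimes {g : CuspForm (Gamma0 N) 2} (hg : IsNewform0 g) :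
    eigenIdeal g ∈ minimalPrimes (anemicHeckeRing N 2) :=
  eigenIdeal_mem_minimalPrimes hg.2.1.isAnemicEigenvector (newform_ne_zero hg)

/-- The congruence modulus of `f_W` with the class of a same-level newform `g`, `𝕀_g ≠ 𝕀_f`, is
non-zero (Pasten 2024 §5.4, tree `heckeCongruenceModulus_ne_zero`). -/
theorem heckeCongruenceModulus_newform_ne_zero (D : ModularParametrizationData W N)
    {g : CuspForm (Gamma0 N) 2} (hg : IsNewform0 g) (hne : eigenIdeal g ≠ eigenIdeal D.f) :
    heckeCongruenceModulus D.f (eigenIdeal g) ≠ 0 :=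
  D.heckeCongruenceModulus_ne_zero (newform_eigenIdeal_mem_minimalPrimes hg) hne

/-- `T_p` acts on the newform of `W` by `a_p(W)` (all primes `p`): `a₁(T_p f) = a_p(f)`
(`qExpansion_coeff_heckeT_holds`), `a₁(f) = 1`, `a_p(f) = a_p(W)` (`IsNewformOf`). -/
theorem datum_heckeT_f_eq_LFunction_smul (D : ModularParametrizationData W N)
    (p : ℕ) [NeZero p] (hp : p.Prime) :
    heckeT (Gamma0 N) 2 p D.f = (W.LFunction p : ℂ) • D.f := by
  obtain ⟨hnew, hcoeff⟩ := D.isNewformOf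
  have heig := heckeT_eq_heckeEigenvalue_smul D.f p (hnew.2.1 p hp)
  have h1 := qExpansion_coeff_heckeT_holds N 2 D.f p hp 1
  have hcoe : ⇑(heckeT (Gamma0 N) 2 p D.f) = heckeEigenvalue D.f p • ⇑D.f := by
    rw [heig]; rfl
  have hnorm : (qExpansion 1 ⇑D.f).coeff 1 = 1 := hnew.2.2
  rw [hcoe, ModularForm.qExpansion_smul one_pos (one_mem_strictPeriods_gamma0 N) _ D.f, map_smul,
    smul_eq_mul, hnorm, mul_one, mul_one, if_neg (Nat.Prime.not_dvd_one hp), mul_zero,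
    ite_self, add_zero] at h1
  rw [heig, h1]
  exact congrArg (· • D.f) (hcoeff p)

/-- `χ₀(T_p) = a_p(W)` for the integral eigencharacter of the newform of `W`, `p ∤ N`. -/
theorem datum_intEigencharacter_T (D : ModularParametrizationData W N)
    (p : ℕ) [NeZero p] (hp : p.Prime) (hpN : ¬ p ∣ N) :
    intEigencharacter D.hasIntegralEigenvalues_f D.f_ne_zero (anemicHeckeRing.T N 2 p hp hpN) =
      W.LFunction p := by
  apply Int.cast_injective (α := ℂ)
  rw [cast_intEigencharacter]
  exact eigencharacter_eq_of_apply_eq_smul _ D.f_ne_zero (by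
    rw [anemicHeckeRing.coe_T]; exact datum_heckeT_f_eq_LFunction_smul D p hp)

/-- `χ₀(T_p) = a_p(W)` with the `NeZero p` instance supplied explicitly (the form in which the
separator sums are written, keeping the statements free of auxiliary definitions). -/
theorem datum_intEigencharacter_T' (D : ModularParametrizationData W N)
    {S : Finset ℕ} (hS : ∀ p ∈ S, p.Prime ∧ ¬ p ∣ N) (p : S) :
    intEigencharacter D.hasIntegralEigenvalues_f D.f_ne_zero
      (@anemicHeckeRing.T N _ 2 (p : ℕ) ⟨(hS p p.2).1.ne_zero⟩ (hS p p.2).1 (hS p p.2).2) =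
      W.LFunction p :=
  @datum_intEigencharacter_T W N _ D (p : ℕ) ⟨(hS p p.2).1.ne_zero⟩ (hS p p.2).1 (hS p p.2).2

end Hecke

/-! ## The E-free transfer: small Hecke separators ⟹ same-level congruence primes are small -/

/-- **Transfer** (SeparatorGlue of card `hasse-separator-transference`): E-free small Hecke
separators and Hasse's bound give the rational-vertex congruence-prime bound with exponent `3A` and
constant `4 (max C 1)³`: for `t = Σ u_p T_p ∈ 𝕀_g ∖ 𝕀_{f_W}`, Pasten's Prop 5.4 gives
`η ∣ χ₀(t) ≠ 0`, so `ℓ ≤ η ≤ |χ₀(t)| = |Σ u_p a_p(W)| ≤ #S · CN^A · 2CN^A ≤ 3 (CN^A)³`. -/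
theorem newPartPrimes_of_smallHeckeSeparators
    (h : ∃ A C : ℝ, ∀ (N : ℕ) [NeZero N] (f g : CuspForm (Gamma0 N) 2), IsNewform0 f →
      IsNewform0 g → HasIntegralEigenvalues f → eigenIdeal f ≠ eigenIdeal g →
      ∃ (S : Finset ℕ) (u : ℕ → ℤ) (hS : ∀ p ∈ S, p.Prime ∧ ¬ p ∣ N),
        (∀ p ∈ S, (p : ℝ) ≤ C * (N : ℝ) ^ A) ∧ (∀ p ∈ S, |(u p : ℝ)| ≤ C * (N : ℝ) ^ A) ∧
        (∑ p ∈ S.attach, u p •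
            @anemicHeckeRing.T N _ 2 (p : ℕ) ⟨(hS p p.2).1.ne_zero⟩ (hS p p.2).1 (hS p p.2).2) ∈
          eigenIdeal g ∧
        (∑ p ∈ S.attach, u p •
            @anemicHeckeRing.T N _ 2 (p : ℕ) ⟨(hS p p.2).1.ne_zero⟩ (hS p p.2).1 (hS p p.2).2) ∉
          eigenIdeal f) :
    ∃ κ C : ℝ, ∀ (N : ℕ) [NeZero N] (W : WeierstrassCurve ℚ) [W.IsElliptic] [W.IsGloballyMinimal],
      W.IsSemistable ℤ → W.conductorNorm ℤ = N →
      ∀ (D : ModularParametrizationData W N) (g : CuspForm (Gamma0 N) 2), IsNewform0 g →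
        eigenIdeal g ≠ eigenIdeal D.f →
        ∀ ℓ : ℕ, ℓ.Prime → ℓ ∣ heckeCongruenceModulus D.f (eigenIdeal g) →
          (ℓ : ℝ) ≤ C * (N : ℝ) ^ κ := by
  obtain ⟨A, C, h⟩ := h
  refine ⟨3 * A, 4 * (max C 1) ^ 3, fun N _ W _ _ _ _ D g hg hne ℓ hℓ hdvd ↦ ?_⟩
  obtain ⟨S, u, hS, hpB, huB, hmem, hnot⟩ :=
    h N D.f g D.isNewformOf.1 hg D.hasIntegralEigenvalues_f hne.symm
  set χ₀ := intEigencharacter D.hasIntegralEigenvalues_f D.f_ne_zero with hχ₀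
  set t := ∑ p ∈ S.attach, u p •
    @anemicHeckeRing.T N _ 2 (p : ℕ) ⟨(hS p p.2).1.ne_zero⟩ (hS p p.2).1 (hS p p.2).2 with htdef
  -- (i) `ℓ ≤ η ≤ |χ₀(t)|`
  have hη0 := heckeCongruenceModulus_newform_ne_zero D hg hne
  have hχ0 : χ₀ t ≠ 0 := by
    intro h0
    apply hnot
    rw [eigenIdeal_eq_ker_intEigencharacter D.hasIntegralEigenvalues_f D.f_ne_zero, RingHom.mem_ker]
    exact h0
  have hηdvd := heckeCongruenceModulus_dvd_of_mem D.hasIntegralEigenvalues_f D.f_ne_zero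
    (P := eigenIdeal g) hmem
  have hℓη : (ℓ : ℝ) ≤ heckeCongruenceModulus D.f (eigenIdeal g) := by
    exact_mod_cast Nat.le_of_dvd (Nat.pos_of_ne_zero hη0) hdvd
  have hηχ : (heckeCongruenceModulus D.f (eigenIdeal g) : ℝ) ≤ |(χ₀ t : ℝ)| := by
    have h1 := Int.le_of_dvd (abs_pos.mpr hχ0) ((dvd_abs _ _).mpr hηdvd)
    have h2 : ((heckeCongruenceModulus D.f (eigenIdeal g) : ℤ) : ℝ) ≤ ((|χ₀ t| : ℤ) : ℝ) := by
      exact_mod_cast h1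
    rw [Int.cast_natCast, Int.cast_abs] at h2
    exact h2
  -- (ii) `χ₀(t) = Σ u_p a_p(W)`
  have hχt : (χ₀ t : ℝ) = ∑ p ∈ S.attach, (u p : ℝ) * (W.LFunction p : ℝ) := by
    rw [htdef, map_sum]
    push_cast
    refine Finset.sum_congr rfl fun p _ ↦ ?_
    rw [map_zsmul, zsmul_eq_mul, datum_intEigencharacter_T' D hS p]
    push_cast
    ring
  -- (iii) `S ≠ ∅` (else `t = 0 ∈ 𝕀_f`), so `M := C N^A ≥ 2`
  set M : ℝ := C * (N : ℝ) ^ A with hMdef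
  have hSne : S.Nonempty := by
    rw [Finset.nonempty_iff_ne_empty]
    rintro rfl
    apply hnot
    rw [htdef, Finset.attach_empty, Finset.sum_empty]
    exact (eigenIdeal D.f).zero_mem
  obtain ⟨p₀, hp₀⟩ := hSne
  have hM2 : (2 : ℝ) ≤ M := by
    have := (hS p₀ hp₀).1.two_le
    exact le_trans (by exact_mod_cast this) (hpB p₀ hp₀)
  have hM0 : (0 : ℝ) ≤ M := by linarith
  -- (iv) termwise Hasse bound `|u_p a_p| ≤ M · 2M`
  have hterm : ∀ p ∈ S.attach, |(u p : ℝ) * (W.LFunction p : ℝ)| ≤ M * (2 * M) := by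
    intro p _
    rw [abs_mul]
    have hu := huB p p.2
    have hp := (hS p p.2).1
    have ha : |(W.LFunction p : ℝ)| ≤ 2 * M := by
      have h1 := W.abs_LFunction_prime_pow_le hp 1
      rw [pow_one, pow_one] at h1
      have hsqrt : Real.sqrt p ≤ (p : ℝ) := by
        rw [Real.sqrt_le_left (by positivity)]
        have : (1 : ℝ) ≤ p := by exact_mod_cast hp.one_le
        nlinarith
      calc |(W.LFunction p : ℝ)| ≤ ((1 : ℕ) + 1) * Real.sqrt p := h1
        _ = 2 * Real.sqrt p := by norm_num
        _ ≤ 2 * (p : ℝ) := by linarith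
        _ ≤ 2 * M := by linarith [hpB p p.2]
    exact mul_le_mul hu ha (abs_nonneg _) hM0
  have hcard : ((S.attach).card : ℝ) ≤ M + 1 := by
    rw [Finset.card_attach]
    exact card_le_of_forall_le hM0 hpB
  -- (v) assemble
  have hN1 : (1 : ℝ) ≤ N := by exact_mod_cast NeZero.one_le
  have hNA : (0 : ℝ) < (N : ℝ) ^ A := Real.rpow_pos_of_pos (by linarith) _
  have hC0 : 0 ≤ C := by
    by_contra hC0
    push Not at hC0
    have : M < 0 := by rw [hMdef]; exact mul_neg_of_neg_of_pos hC0 hNA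
    linarith
  calc (ℓ : ℝ) ≤ heckeCongruenceModulus D.f (eigenIdeal g) := hℓη
    _ ≤ |(χ₀ t : ℝ)| := hηχ
    _ = |∑ p ∈ S.attach, (u p : ℝ) * (W.LFunction p : ℝ)| := by rw [hχt]
    _ ≤ ∑ p ∈ S.attach, |(u p : ℝ) * (W.LFunction p : ℝ)| := Finset.abs_sum_le_sum_abs _ _
    _ ≤ ∑ p ∈ S.attach, M * (2 * M) := Finset.sum_le_sum hterm
    _ = (S.attach).card * (M * (2 * M)) := by rw [Finset.sum_const, nsmul_eq_mul]
    _ ≤ (M + 1) * (M * (2 * M)) := mul_le_mul_of_nonneg_right hcard (by positivity)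
    _ ≤ 3 * M ^ 3 := by nlinarith [mul_nonneg (mul_nonneg hM0 hM0) (sub_nonneg.mpr hM2)]
    _ ≤ 4 * (max C 1) ^ 3 * (N : ℝ) ^ (3 * A) := by
        have hC : C ≤ max C 1 := le_max_left _ _
        have hpow : (N : ℝ) ^ (3 * A) = ((N : ℝ) ^ A) ^ 3 := by
          rw [mul_comm, Real.rpow_mul (by linarith)]; norm_cast
        rw [hpow, hMdef, mul_pow]
        have h1 : C ^ 3 ≤ (max C 1) ^ 3 := pow_le_pow_left₀ hC0 hC 3
        have h2 : 0 ≤ ((N : ℝ) ^ A) ^ 3 := by positivity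
        have h3 : C ^ 3 * ((N : ℝ) ^ A) ^ 3 ≤ (max C 1) ^ 3 * ((N : ℝ) ^ A) ^ 3 :=
          mul_le_mul_of_nonneg_right h1 h2
        have h4 : 0 ≤ (max C 1) ^ 3 * ((N : ℝ) ^ A) ^ 3 :=
          mul_nonneg (pow_nonneg (le_trans zero_le_one (le_max_right _ _)) 3) h2
        linarith

/-! ## The glue -/

/-- STUB (PROVED) — **the glue of line `Sketch`**: statements (1)–(6) of the module docstring imply
crux A ((1) split as: existence of a datum for semistable minimal `W` + the Mazur–Kenku size fact
`PastenShimura2024_minimalDegree_le_163_mul`, turned into product form by the tree's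
`PastenShimura2024_exists_datum_modularDegree_eq_mul_of`).  Given `W`, take any datum `D₁`, a
class-minimal datum `D₀` with the same newform (well-ordering), and the datum `D` of `W` of degree
`k · deg D₀`; a prime `ℓ ∣ deg D` divides
`k ≤ 163` or `deg D₀ ∣ ∏ η(P)` (2) hence one `η_f(P)`, `P ≠ 𝕀_f` minimal; classify `P` by (3):
new ⇒ the transferred bet (6), old ⇒ `ℓ ≤ v_p(Δ_min) ≤ C N^κ` by (4), (5), or `ℓ ∣ N`, or `ℓ < 11`.
Constants: `κ = max(κ₅, 3A, 1)`, `C = max C₅ 0 + 4 (max C₆ 1)³ + 163`. -/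
theorem stub_glue :
    (∀ (W : WeierstrassCurve ℚ) [W.IsElliptic] [W.IsGloballyMinimal] [NeZero (W.conductorNorm ℤ)],
      W.IsSemistable ℤ → Nonempty (ModularParametrizationData W (W.conductorNorm ℤ))) →
    PastenShimura2024_minimalDegree_le_163_mul →
    PastenShimura2024_thm_5_5 →
    (∀ (N : ℕ) [NeZero N] (P : Ideal (anemicHeckeRing N 2)),
      P ∈ minimalPrimes (anemicHeckeRing N 2) →
      (∃ g : CuspForm (Gamma0 N) 2, IsNewform0 g ∧ P = eigenIdeal g) ∨
      (∃ (M : ℕ) (_ : NeZero M) (hM : M ∣ N), M ≠ N ∧ ∃ g : CuspForm (Gamma0 M) 2,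
        IsNewform0 g ∧ P = eigenIdeal (toLevel0 hM 2 g))) →
    (∀ (N : ℕ) [NeZero N] (W : WeierstrassCurve ℚ) [W.IsElliptic] [W.IsGloballyMinimal],
      W.IsSemistable ℤ → W.conductorNorm ℤ = N →
      ∀ (D : ModularParametrizationData W N) (M : ℕ) [NeZero M] (hM : M ∣ N), M ≠ N →
      ∀ g : CuspForm (Gamma0 M) 2, IsNewform0 g →
      ∀ ℓ : ℕ, ℓ.Prime →
        heckeCongruenceModulus D.f (eigenIdeal (toLevel0 hM 2 g)) ≠ 0 →
        ℓ ∣ heckeCongruenceModulus D.f (eigenIdeal (toLevel0 hM 2 g)) →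
        (∃ p : ℕ, p.Prime ∧ p ∣ N ∧ 0 < (W.minimalDiscriminantNorm ℤ).factorization p ∧
            ℓ ∣ (W.minimalDiscriminantNorm ℤ).factorization p) ∨ ℓ ∣ N ∨ ℓ < 11) →
    (∃ κ C : ℝ, ∀ (W : WeierstrassCurve ℚ) [W.IsElliptic] [W.IsGloballyMinimal]
      [NeZero (W.conductorNorm ℤ)], W.IsSemistable ℤ → ∀ p : ℕ,
        (((W.minimalDiscriminantNorm ℤ).factorization p : ℕ) : ℝ) ≤
          C * (W.conductorNorm ℤ : ℝ) ^ κ) →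
    (∃ A C : ℝ, ∀ (N : ℕ) [NeZero N] (f g : CuspForm (Gamma0 N) 2), IsNewform0 f →
      IsNewform0 g → HasIntegralEigenvalues f → eigenIdeal f ≠ eigenIdeal g →
      ∃ (S : Finset ℕ) (u : ℕ → ℤ) (hS : ∀ p ∈ S, p.Prime ∧ ¬ p ∣ N),
        (∀ p ∈ S, (p : ℝ) ≤ C * (N : ℝ) ^ A) ∧ (∀ p ∈ S, |(u p : ℝ)| ≤ C * (N : ℝ) ^ A) ∧
        (∑ p ∈ S.attach, u p •
            @anemicHeckeRing.T N _ 2 (p : ℕ) ⟨(hS p p.2).1.ne_zero⟩ (hS p p.2).1 (hS p p.2).2) ∈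
          eigenIdeal g ∧
        (∑ p ∈ S.attach, u p •
            @anemicHeckeRing.T N _ 2 (p : ℕ) ⟨(hS p p.2).1.ne_zero⟩ (hS p p.2).1 (hS p p.2).2) ∉
          eigenIdeal f) →
    DegreePrimesPolyBounded := by
  intro h1 hMK h2 h4 h5 h6 hsep
  classical
  obtain ⟨κ₆, C₆, h6⟩ := h6
  obtain ⟨κ₇, C₇, h7⟩ := newPartPrimes_of_smallHeckeSeparators hsep
  refine ⟨max (max κ₆ κ₇) 1, max C₆ 0 + max C₇ 0 + 163, ?_⟩
  intro W _ _ _ hW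
  -- constants
  set κ : ℝ := max (max κ₆ κ₇) 1 with hκdef
  set C : ℝ := max C₆ 0 + max C₇ 0 + 163 with hCdef
  have hκ6 : κ₆ ≤ κ := (le_max_left _ _).trans (le_max_left _ _)
  have hκ7 : κ₇ ≤ κ := (le_max_right _ _).trans (le_max_left _ _)
  have hκ1 : 1 ≤ κ := le_max_right _ _
  have hC6 : C₆ ≤ C := by
    have : (0 : ℝ) ≤ max C₇ 0 := le_max_right _ _
    linarith [le_max_left C₆ 0]
  have hC7 : C₇ ≤ C := by
    have : (0 : ℝ) ≤ max C₆ 0 := le_max_right _ _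
    linarith [le_max_left C₇ 0]
  have hC163 : (163 : ℝ) ≤ C := by
    have h1' : (0 : ℝ) ≤ max C₆ 0 := le_max_right _ _
    have h2' : (0 : ℝ) ≤ max C₇ 0 := le_max_right _ _
    linarith
  have hC1 : (1 : ℝ) ≤ C := by linarith
  have hC0 : (0 : ℝ) ≤ C := by linarith
  set N : ℕ := W.conductorNorm ℤ with hNdef
  have hN1 : (1 : ℝ) ≤ (N : ℝ) := by exact_mod_cast NeZero.one_le
  -- a datum of `W`; a class-minimal datum with the same newform (well-ordering of `ℕ`);
  -- the datum of `W` of degree `k · deg D₀`, `k ≤ 163` (Mazur–Kenku in product form)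
  obtain ⟨D₁⟩ := h1 W hW
  let S : Set ℕ := {n | ∃ (W' : WeierstrassCurve ℚ) (_ : W'.IsElliptic)
    (D' : ModularParametrizationData W' N), D'.f = D₁.f ∧ D'.modularDegree = n}
  have hS : ∃ n, n ∈ S := ⟨D₁.modularDegree, W, inferInstance, D₁, rfl, rfl⟩
  obtain ⟨W₀, hW₀ell, D₀, hf₀, hdeg₀⟩ := Nat.find_spec hS
  have hmin : ∀ (W' : WeierstrassCurve ℚ) [W'.IsElliptic] (D' : ModularParametrizationData W' N),
      D'.f = D₀.f → D₀.modularDegree ≤ D'.modularDegree := by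
    intro W' _ D' hf'
    rw [hdeg₀]
    exact Nat.find_min' hS ⟨W', inferInstance, D', hf'.trans hf₀, rfl⟩
  obtain ⟨D, k, hfD, hk0, hk163, hdegD⟩ :=
    PastenShimura2024_exists_datum_modularDegree_eq_mul_of hMK N W₀ W D₀ D₁ hf₀.symm hmin
  refine ⟨D, fun ℓ hℓ hdvd ↦ ?_⟩
  change ℓ ∣ D.modularDegree at hdvd
  rw [hdegD] at hdvd
  rcases (Nat.Prime.dvd_mul hℓ).mp hdvd with hk | hδ
  · -- `ℓ ∣ k ≤ 163`
    have : (ℓ : ℝ) ≤ 163 := by exact_mod_cast (Nat.le_of_dvd hk0 hk).trans hk163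
    exact le_mul_rpow_of_le (this.trans hC163) hC0 (zero_le_one.trans hκ1) hN1
  · -- `ℓ ∣ deg D₀ ∣ ∏ η(P)`
    have hprod := h2 N W₀ D₀ hmin
    have hℓprod := hδ.trans hprod
    obtain ⟨P, hPmem, hℓP⟩ := (Nat.prime_iff.mp hℓ).exists_mem_finset_dvd hℓprod
    have hPne : P ≠ eigenIdeal D₀.f := Finset.ne_of_mem_erase hPmem
    have hPmin : P ∈ minimalPrimes (anemicHeckeRing N 2) :=
      (finite_minimalPrimes_anemicHeckeRing N 2).mem_toFinset.mp (Finset.mem_of_mem_erase hPmem)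
    -- move everything to the datum `D` of `W` (same newform)
    have hff : D₀.f = D.f := hfD.symm
    rw [hff] at hPne hℓP
    have hη0 : heckeCongruenceModulus D.f P ≠ 0 := D.heckeCongruenceModulus_ne_zero hPmin hPne
    rcases h4 N P hPmin with ⟨g, hg, rfl⟩ | ⟨M, hM0, hM, hMN, g, hg, rfl⟩
    · -- new partner: the (transferred) bet
      have := h7 N W hW rfl D g hg hPne ℓ hℓ hℓP
      exact le_of_le_mul_rpow this hC7 hκ7 hC0 hN1
    · -- old partner: Tamagawa exponent, or `ℓ ∣ N`, or `ℓ < 11`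
      rcases h5 N W hW rfl D M hM hMN g hg ℓ hℓ hη0 hℓP with
        ⟨p, hp, hpN, hvpos, hℓv⟩ | hℓN | hℓ11
      · have h1' : (ℓ : ℝ) ≤ ((W.minimalDiscriminantNorm ℤ).factorization p : ℕ) := by
          exact_mod_cast Nat.le_of_dvd hvpos hℓv
        exact le_of_le_mul_rpow (h1'.trans (h6 W hW p)) hC6 hκ6 hC0 hN1
      · have h1' : (ℓ : ℝ) ≤ (N : ℝ) := by exact_mod_cast Nat.le_of_dvd NeZero.one_le hℓN
        exact h1'.trans (self_le_mul_rpow hC1 hκ1 hN1)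
      · have h1' : (ℓ : ℝ) ≤ 163 := by exact_mod_cast (by omega : ℓ ≤ 163)
        exact le_mul_rpow_of_le (h1'.trans hC163) hC0 (zero_le_one.trans hκ1) hN1

end Summit.ABC.ABC.Theorems.DegreePrimesPolyBounded

end
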